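import Mathlib
import Summits.Ventures.HodgeRepro.Tier4.Target

/-!
# Tier4/Common/TargetCalculus — the calculus of the frozen target's objects: `heckeTranslate`, `comp`, `pd`, `jacDet`

Blind re-derivation cell `pub-hodge-repro`, Tier 4 (README §9–§10), seat t4-typer-2 (gen 0).  Target tree path
`lean/Summits/Ventures/HodgeRepro/Tier4/Common/TargetCalculus.lean`.  Imports the FROZEN `Tier4/Target.lean`
(sha256 7e1ddb58699909ce…, 263 l., lead g384 S11958) — never edits it, only proves lemmas ABOUT its definitions, so
that every `target_Lk : P_T4` manipulates the target's objects through one shared file instead of four.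

WHAT IS PROVED (Mathlib only, no hypothesis beyond the differentiability the statements need):
* `heckeTranslate` (Target §D): the one-term form `heckeTranslate_term`, the identity coset
  `heckeTranslate_identity` (`R = {1}` and `C` invertible ⇒ `T a = a`), ℤ-additivity / ℂ-homogeneity in the lift
  (`heckeTranslate_add`, `heckeTranslate_smul`), and commutation with the coordinate `comp`
  (`comp_heckeTranslate`: the `s`-coordinate of a translate is the translate of the `s`-coordinate);
* `actM` / `toBallMat`: `toBallMat_one`, `actM_one` (the identity matrix acts trivially on `ℂ²`);
* `pd` / `jacDet` (Target §E): `pd_add`, `pd_smul`, `pd_const`, `pd_add_const`; `jacDet_swap`, `jacDet_self`,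
  `jacDet_add_left/right`, `jacDet_smul_left/right` — the wedge of the differentials is sesquilinear-ready
  (bilinear and alternating);
* the CHAIN RULE `pd_comp` (`∂_k (u ∘ φ) z = Σ_j ∂_j u (φ z) · ∂_k φ_j z`, Mathlib `fderiv_comp` + `fderiv_pi`) and
  **`jacDet_comp`** — `jacDet (u ∘ φ) (v ∘ φ) z = jacDet u v (φ z) * jacDetMap φ z` with `jacDetMap φ z` the
  determinant of the Jacobian matrix of `φ`: the identity that turns the pull-back of a wedge into the wedge of the
  pull-backs times the automorphy factor (the sealed `BallModel.Jac` / `HeckeWedge` shape), which is how a single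
  translate `a ∘ M(r)` of the lifts enters the target's Jacobians.

Nothing here says anything about the status of the Hodge conjecture for CM abelian varieties, which is NOT proved
(HC_CM is NOT proved by anyone in this repository).
-/

set_option autoImplicit false

noncomputable section

namespace Summit.Ventures.HodgeRepro.Tier4

open scoped BigOperators

/-! ## 1. The ball action of the identity -/

/-- `lift3 z` has third coordinate `1`. -/
theorem lift3_two (z : Fin 2 → ℂ) : lift3 z 2 = 1 := rfl

/-- The identity matrix acts trivially: `actM 1 z = z`. -/
theorem actM_one (z : Fin 2 → ℂ) : actM 1 z = z := by
  funext k
  simp only [actM, Matrix.one_mulVec]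
  rw [lift3_two, div_one]
  fin_cases k <;> rfl

/-- `toBallMat τ₀ C 1 = 1` for an invertible `C`. -/
theorem toBallMat_one {E : Type*} [Field E] (τ₀ : E →+* ℂ) {C : Matrix (Fin 3) (Fin 3) ℂ} (hC : IsUnit C) :
    toBallMat τ₀ C 1 = 1 := by
  simp only [toBallMat, Matrix.map_one τ₀ (map_zero τ₀) (map_one τ₀), Matrix.mul_one]
  exact Matrix.nonsing_inv_mul C ((Matrix.isUnit_iff_isUnit_det C).mp hC)

/-! ## 2. Hecke translates -/

section Hecke

variable {E : Type*} [Field E] {W : Type*} [AddCommGroup W] (τ₀ : E →+* ℂ) (C : Matrix (Fin 3) (Fin 3) ℂ)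

/-- A Hecke element with ONE term `(c, R)` acts as `c • Σ_{r ∈ R} a (M(r) z)` (the lead's `TargetApi.heckeTranslate_single`
/ `heckeTranslate_coset` are the cases `c = 1`, `R = {γ}` / `R` arbitrary). -/
theorem heckeTranslate_term (c : ℤ) (R : Finset (Matrix (Fin 3) (Fin 3) E)) (a : (Fin 2 → ℂ) → W)
    (z : Fin 2 → ℂ) :
    heckeTranslate τ₀ C ⟨[(c, R)]⟩ a z = c • R.sum (fun r => a (actM (toBallMat τ₀ C r) z)) := by
  simp [heckeTranslate]

/-- The identity double coset (`c = 1`, `R = {1}`) acts trivially for an invertible `C`. -/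
theorem heckeTranslate_identity {C : Matrix (Fin 3) (Fin 3) ℂ} (hC : IsUnit C) (a : (Fin 2 → ℂ) → W)
    (z : Fin 2 → ℂ) : heckeTranslate τ₀ C ⟨[(1, {1})]⟩ a z = a z := by
  rw [heckeTranslate_term, Finset.sum_singleton, toBallMat_one τ₀ hC, actM_one, one_smul]

/-- The Hecke translate is additive in the lift. -/
theorem heckeTranslate_add (h : HeckeElement E) (a b : (Fin 2 → ℂ) → W) :
    heckeTranslate τ₀ C h (a + b) = heckeTranslate τ₀ C h a + heckeTranslate τ₀ C h b := by
  funext z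
  simp only [heckeTranslate, Pi.add_apply, Finset.sum_add_distrib, smul_add]
  rw [← List.sum_map_add]

/-- The Hecke translate is ℂ-homogeneous in the lift (for a ℂ-module `W`). -/
theorem heckeTranslate_smul [Module ℂ W] (h : HeckeElement E) (c : ℂ) (a : (Fin 2 → ℂ) → W) :
    heckeTranslate τ₀ C h (c • a) = c • heckeTranslate τ₀ C h a := by
  funext z
  simp only [heckeTranslate, Pi.smul_apply, ← Finset.smul_sum, smul_comm _ c]
  rw [List.smul_sum, List.map_map]
  rfl

/-- The Hecke translate of the zero lift is zero. -/
theorem heckeTranslate_zero (h : HeckeElement E) : heckeTranslate τ₀ C h (0 : (Fin 2 → ℂ) → W) = 0 := by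
  funext z
  simp [heckeTranslate]

end Hecke

/-- The `s`-coordinate of a Hecke translate is the Hecke translate of the `s`-coordinate. -/
theorem comp_heckeTranslate {K : Type*} [Field K] {E : Type*} [Field E] (T : Finset (K →+* ℂ)) (s : K →+* ℂ)
    (hs : s ∈ T) (τ₀ : E →+* ℂ) (C : Matrix (Fin 3) (Fin 3) ℂ) (h : HeckeElement E)
    (A : (Fin 2 → ℂ) → (↥T → ℂ)) :
    comp T s hs (heckeTranslate τ₀ C h A) = heckeTranslate τ₀ C h (comp T s hs A) := by
  funext z
  simp only [comp, heckeTranslate]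
  rw [Pi.list_sum_apply, List.map_map]
  congr 1
  refine List.map_congr_left fun t _ => ?_
  simp only [Function.comp, Pi.smul_apply, Finset.sum_apply]

/-! ## 3. Partial derivatives and the Jacobian determinant -/

section Calculus

variable {u v : (Fin 2 → ℂ) → ℂ} {z : Fin 2 → ℂ}

/-- `pd` of a sum. -/
theorem pd_add (k : Fin 2) (hu : DifferentiableAt ℂ u z) (hv : DifferentiableAt ℂ v z) :
    pd k (u + v) z = pd k u z + pd k v z := by
  simp only [pd, fderiv_add hu hv]
  rfl

/-- `pd` of a scalar multiple. -/
theorem pd_smul (k : Fin 2) (c : ℂ) (hu : DifferentiableAt ℂ u z) : pd k (c • u) z = c * pd k u z := by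
  simp only [pd, fderiv_const_smul hu c]
  rfl

/-- `pd` of a constant. -/
theorem pd_const (k : Fin 2) (c : ℂ) : pd k (fun _ => c) z = 0 := by
  simp only [pd]
  rw [show (fun _ : Fin 2 → ℂ => c) = Function.const (Fin 2 → ℂ) c from rfl, fderiv_const]
  rfl

/-- `pd` is unchanged by adding a constant. -/
theorem pd_add_const (k : Fin 2) (c : ℂ) (hu : DifferentiableAt ℂ u z) :
    pd k (fun w => u w + c) z = pd k u z := by
  have : (fun w => u w + c) = u + fun _ => c := rfl
  rw [this, pd_add k hu (differentiableAt_const c), pd_const, add_zero]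

/-- The Jacobian determinant is antisymmetric. -/
theorem jacDet_swap (u v : (Fin 2 → ℂ) → ℂ) (z : Fin 2 → ℂ) : jacDet u v z = -jacDet v u z := by
  simp only [jacDet, wedge]; ring

/-- The Jacobian determinant of a function with itself vanishes. -/
theorem jacDet_self (u : (Fin 2 → ℂ) → ℂ) (z : Fin 2 → ℂ) : jacDet u u z = 0 := by
  simp only [jacDet, wedge]; ring

/-- `jacDet` is additive in the first slot. -/
theorem jacDet_add_left {u' : (Fin 2 → ℂ) → ℂ} (hu : DifferentiableAt ℂ u z) (hu' : DifferentiableAt ℂ u' z) :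
    jacDet (u + u') v z = jacDet u v z + jacDet u' v z := by
  simp only [jacDet, wedge, pd_add _ hu hu']; ring

/-- `jacDet` is additive in the second slot. -/
theorem jacDet_add_right {v' : (Fin 2 → ℂ) → ℂ} (hv : DifferentiableAt ℂ v z) (hv' : DifferentiableAt ℂ v' z) :
    jacDet u (v + v') z = jacDet u v z + jacDet u v' z := by
  simp only [jacDet, wedge, pd_add _ hv hv']; ring

/-- `jacDet` is homogeneous in the first slot. -/
theorem jacDet_smul_left (c : ℂ) (hu : DifferentiableAt ℂ u z) : jacDet (c • u) v z = c * jacDet u v z := by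
  simp only [jacDet, wedge, pd_smul _ c hu]; ring

/-- `jacDet` is homogeneous in the second slot. -/
theorem jacDet_smul_right (c : ℂ) (hv : DifferentiableAt ℂ v z) : jacDet u (c • v) z = c * jacDet u v z := by
  simp only [jacDet, wedge, pd_smul _ c hv]; ring

/-- Adding constants to `u` and `v` does not change `jacDet`. -/
theorem jacDet_add_const (c d : ℂ) (hu : DifferentiableAt ℂ u z) (hv : DifferentiableAt ℂ v z) :
    jacDet (fun w => u w + c) (fun w => v w + d) z = jacDet u v z := by
  simp only [jacDet, pd_add_const _ _ hu, pd_add_const _ _ hv]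

/-- The directional derivative along `Pi.single k 1` of `u` is `pd k u`, and `fderiv` is recovered from the two
partials: `fderiv ℂ u z w = Σ_k w k * pd k u z`. -/
theorem fderiv_apply_eq_sum_pd (u : (Fin 2 → ℂ) → ℂ) (z w : Fin 2 → ℂ) :
    fderiv ℂ u z w = ∑ k, w k * pd k u z := by
  have hw : w = ∑ k, w k • Pi.single (M := fun _ => ℂ) k (1 : ℂ) := pi_eq_sum_univ' w
  conv_lhs => rw [hw]
  rw [map_sum]
  refine Finset.sum_congr rfl fun k _ => ?_
  rw [map_smul, smul_eq_mul]
  rfl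

/-- The Jacobian determinant of a self-map `φ` of `ℂ²`: `det (∂_k φ_j)`. -/
def jacDetMap (φ : (Fin 2 → ℂ) → (Fin 2 → ℂ)) (z : Fin 2 → ℂ) : ℂ :=
  wedge (fun k => pd k (fun w => φ w 0) z) (fun k => pd k (fun w => φ w 1) z)

/-- **The chain rule for `pd`**: `∂_k (u ∘ φ) z = Σ_j ∂_j u (φ z) · ∂_k φ_j z`. -/
theorem pd_comp (k : Fin 2) {φ : (Fin 2 → ℂ) → (Fin 2 → ℂ)} (hu : DifferentiableAt ℂ u (φ z))
    (hφ : DifferentiableAt ℂ φ z) :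
    pd k (u ∘ φ) z = ∑ j, pd j u (φ z) * pd k (fun w => φ w j) z := by
  simp only [pd]
  rw [fderiv_comp z hu hφ, ContinuousLinearMap.comp_apply,
    fderiv_apply_eq_sum_pd u (φ z) (fderiv ℂ φ z (Pi.single k 1))]
  refine Finset.sum_congr rfl fun j _ => ?_
  rw [mul_comm]
  congr 1
  rw [fderiv_apply hφ j]
  rfl

/-- **The chain rule for the Jacobian determinant**: `jacDet (u ∘ φ) (v ∘ φ) z = jacDet u v (φ z) * jacDetMap φ z`. -/
theorem jacDet_comp {φ : (Fin 2 → ℂ) → (Fin 2 → ℂ)} (hu : DifferentiableAt ℂ u (φ z))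
    (hv : DifferentiableAt ℂ v (φ z)) (hφ : DifferentiableAt ℂ φ z) :
    jacDet (u ∘ φ) (v ∘ φ) z = jacDet u v (φ z) * jacDetMap φ z := by
  simp only [jacDet, jacDetMap, wedge, pd_comp _ hu hφ, pd_comp _ hv hφ, Fin.sum_univ_two]
  ring

end Calculus

end Summit.Ventures.HodgeRepro.Tier4

end
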